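import Literature.MathematicalPhysics.QuantumFieldTheory.Balaban1983to89.B8Eq191FlatStencils
import Literature.MathematicalPhysics.QuantumFieldTheory.Balaban1983to89.B8LeafModelZd3NonVacuity
import Literature.MathematicalPhysics.QuantumFieldTheory.Balaban1983to89.B8Thm8Surviving
import Literature.MathematicalPhysics.QuantumFieldTheory.Balaban1983to89.Node00.CarriersB8SubB

/-!
# `Balaban1983to89.B8LeafModelZd3SourceReality` — [Balaban1985RegularSpaces] THEOREM 8 (p. 101) IN ITS SURVIVING FORM
# (`B8Thm8Surviving.Thm8SurvivingAt γ B₁ B₂`) IS FALSE AT NODE 00's CARRIER `B8LeafModelZd3.zdGF3` ON EVERY FAMILY CONTAINING AN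
# ALL-`ℤᵈ` MEMBER — because the typed source space `Src := Site d → 𝔸`, `InR := InR138` FORGETS print's «Lie algebra valued»:
# the imaginary source `I•Δλ₀ ∈ R(1)` admits no solution of (1.146) with a unitary gauge transformation.  Consequently the [B8]
# slots of record `Node00.B8LeafOfRecord ∕ …Sub ∕ …SubB θ λ` are UNINHABITED for every residual layer `λ` (companion of n05-a's
# `B8LeafModelZd3Boundary`, which excluded the `Ω₀ ≠ ℤᵈ` members; this file reaches the `Ω₀ = ℤᵈ` members of record)

statement-level skeleton of published theorems with citation tags; proofs where landed; nothing here is a claim about the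
Yang–Mills mass gap

T. Bałaban, *Spaces of regular gauge field configurations on a lattice and gauge fixing conditions*, Commun. Math. Phys. **99** (1985)
75–102 `[Balaban1985RegularSpaces]` ("B8"; journal page = PDF page + 74; PDF held `paper:balaban1985-cmp99-regular-spaces-gauge-fixing`).
p. 101 [PDF 27], verbatim: *"Let us consider the equation R(U₀)D^{η*}_{U₀}A = f, (1.146) where f is a function from the space R(U₀), i.e. a
**Lie algebra valued** function defined on Ω₀ and satisfying R(U₀)f = f. … Theorem 8. … there exists exactly one gauge transformation
u satisfying (1.29) and such that U₁ = U′^{u⁻¹} … satisf[ies] … the equation (1.146)"*; p. 80 (1.27) «the real Hilbert space L²(Ω₀, 𝔤)»;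
[4] = T. Bałaban, *Propagators for lattice gauge theories in a background field*, CMP **99** (1985) 389–434, (3.19)–(3.25) pp. 393–394.

## WHY THIS FILE (cell `pub-ymgap`, HUMAN RULING D-0062; R134 seat `pub-ymgap-dag-n05-c` g5, DAG node N05 = [B8]; a LOCATED NEGATIVE, count-neutral)

NODE 00's [B8] family of record is `Node00.famB8OfRecord θ β len i := zdGF3 θ.𝔸 θ.L β len i.1` over `IdxB8 θ = {i : ZdIdx // i.Ω 0 = univ}` (and
its law-cut sub-families `IdxB8Sub`, `B8IdxB8LawsB.IdxB8SubB`), and the N05 knits of record conclude the surviving leaf `B8LeafKnitRS.B8LeafRS …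
(famB8OfRecordSubB θ β len) …` whose conjunct `t8` is `Thm8SurvivingAt 1 B₁ B₂ fam` — Theorem 8 quantified over EVERY `f : (fam i).Src` with
`(fam i).InR U₀ f` and `(fam i).fNorm f < γ(α₀ + α₁)`.  At `zdGF3`: `Src := Site d → 𝔸` (ALL `𝔸`-valued functions), `InR U₀ f := InR138 …`
(«`f = Δ^η_{U₀}↾Ω₀ λ` on `Ω₀` for some `λ` with `Q′_j(U₀)λ = 0` on `Λ_j`» — a `ℂ`-LINEAR condition) and `fNorm := msup … (−2)`.  So with any
Hermitian («Lie algebra valued») `f₀ ∈ R(U₀)` the NON-Hermitian `I•f₀` is an admitted source of the same norm.  For such a source (1.146)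
has no solution: in multiplier form (`B8Eq138LandauZd.IsLandau146`) it reads `Δ↾Ω₀(D^{η*}_{U₀}A′ − I•f₀) = Q′(U₀)ᵀμ`, where `A′ = (1/iη) log U₁`
is HERMITIAN on the bonds of `Ω₀` by the (1.62)-clause the surviving form asserts; pairing with the `N(Q′)`-witness `λ₀` of `f₀` kills the
`Q′ᵀ`-term and the Hermitian term and leaves `I·Σ|Δλ₀|² = 0`.  THIS FILE runs that argument in the kernel at the simplest datum — `U₀ = U′ = 1`,
an all-`ℤᵈ` LamTop member (`Ω_j = ℤᵈ`, `Λs m j = {j = m}`; n05-a's `B8LeafModelZd3NonVacuity.exists_member_univ`, a LAW member by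
`B8IdxB8LawsB.idxB8LawsB_of_member_univ`), `λ₀ = r(δ₀ − δ_{e₀})·1` (zero block sums at every level `j ≥ 1`, `L ≥ 2`) — using n05-e's flat
stencils (`B8Eq191FlatStencils`: at `U₀ = 1`, `Q′ᵀμ(x)` depends on `x` only through its `Lʲ`-block, `QT_flat_apply`) and a flat summation by
parts for real finitely supported functions (§2).

## WHAT IS PROVED (kernel, 0 sorry, theorems only; axioms `propext` ∕ `Classical.choice` ∕ `Quot.sound`)

* §1 flat bookkeeping at `U₀ = 1` (`covLap_flat_realSmul_one`, `covLap_flat_constSmul`, `covLap_flat_sub`, `norm_covLap_flat_le`,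
  `isSelfAdjoint_covDivB_flat`, `isSelfAdjoint_covLap_flat`); §2 the real flat Laplacian as a letter `G` with its stencil law: support
  (`support_flatLap_subset`), the shift identity (`finsum_mul_shift`, `sum_mul_shift_eq`), SUMMATION BY PARTS on a finite set
  (`sum_mul_flatLap_comm`: `Σ a·G b = Σ G a·b`), and the dipole inequality **`flatLap_dipole_pos`**: `0 < G(Gc)(0) − G(Gc)(e_μ₀)` for
  `c = r(δ₀ − δ_{e_μ₀})` (`= r⁻¹Σ(Gc)²`, and `(Gc)(0) = (2d+1)r η⁻² ≠ 0`).
* §3 `QT_flat_lamTop_eq` (the multiplier term takes the same value at `0` and `e_μ₀`), `star_smul_one_eq` (`z•1` Hermitian ⇒ `z` real),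
  ★ **`not_thm8SurvivingAt_zdGF3_lamTop`**: for `d ≥ 2`, `L ≥ 2`, every `β, len`, every `γ > 0`, `B₁, B₂`, every index map `ι : J → ZdIdx d L`
  hitting an all-`ℤᵈ` LamTop member: `¬ Thm8SurvivingAt γ B₁ B₂ (zdGF3 𝔸 L β len ∘ ι)`; `not_thm8SurvivingAt_zdGF3_univ` (the sub-family
  `{i // i.Ω 0 = univ}` of this seat's g4 `B8Thm8SurvivingZd3.thm8SurvivingAt_zd3_univ_lan` — so that theorem's five sourced sockets are
  JOINTLY UNSATISFIABLE for every admissible `LanF`).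
* §4 at the record: **`not_thm8SurvivingAt_famB8OfRecord ∕ …Sub ∕ …SubB`** (every `θ` with `θ.D ≥ 2`), `not_b8LeafRS_famB8OfRecordSubB` (every
  parameter set and every `loc ∕ lan ∕ cub ∕ toAxial`), ★★ **`not_b8LeafOfRecord`, `not_b8LeafOfRecordSub`, `not_b8LeafOfRecordSubB`**:
  NODE 00's [B8] slots of record are uninhabited for EVERY residual layer `λ : ResidB8 θ`.

## READING (for the table; nothing of print is refuted)

(i) The typed sentence `Thm8SurvivingAt` over `zdGF3` is STRONGER than print's Theorem 8: it quantifies over non-Lie-algebra-valued sources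
(and, through the real-`iSup` convention of `B8ScaledSupNorm.msup`, over unbounded ones, whose «norm» is the junk value `0`); print's `f` is
Lie algebra valued on a finite torus.  (ii) Hence every knit concluding `B8LeafRS … (famB8OfRecordSubB …) …` (or the slot `B8LeafOfRecordSubB`)
has jointly unsatisfiable hypotheses: in the knits displaying `t8` as a hypothesis the culprit is that hypothesis; in the T8-supplied knits it
is the conjunction of the sourced sockets (`SP5base ∕ SP5 ∕ SP5u ∕ SH59src ∕ SB9src`), of which the Prop.-5 EXISTENCE sockets must serve a
unitary gauge transformation at the sourced gauge condition for non-Hermitian sources.  (iii) REPAIR (consumer-safe, one field): read «f from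
the space R(U₀)» WITH Lie-algebra values and finite norm — `InR U₀ f := InR138 … f ∧ (∀ x, IsSelfAdjoint (f x)) ∧ B8ScaledSupNorm.Bdd L k η (−2)
(· ∈ Ω ·) f` at the carrier (every other field of `zdGF3` untouched, so Lemma 1 ∕ Thm 2 ∕ Prop 3 ∕ Thm 4 ∕ Props 5–7 instances transfer
verbatim) and the same two clauses in the premiss of the sourced sockets.  (iv) Nothing of n05-a's Theorem 2 ∕ 4, Proposition 3 instances, of
the un-sourced knits' other conjuncts, or of [4] is affected: they do not read `Src`.

## HONEST SCOPE

A statement about the TYPING of the carrier of record (which sources `Src`/`InR` admit), proved by elementary lattice algebra at the flat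
datum; not about Bałaban's theorem on his torus with his gauge group; no estimate of [Balaban1985RegularSpaces] or [4] is used or asserted.
Count-neutral; N05 NOT discharged (the opposite: its slot of record is shown uninhabitable as typed); `T_η ↦ ℤᵈ`, `G = U(𝔸)`; one finite `T⁴`
programme at fixed `ε`, Bałaban as printed — nothing continuum ∕ ℝ⁴ ∕ OS ∕ mass-gap ∕ Clay.  No `sorry`, no `def`, no `instance`, no `notation`.
Unit `pub-ymgap-dag-n05-c` (g5), 2026-08-27.

[cite: Balaban1985RegularSpaces, Thm 8 (1.146) p.101 («Lie algebra valued»), (1.27) p.80, (1.38) p.82, (1.62) p.87, (1.29) p.81, (1.5) p.77,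
p.77 («we admit Ω_j = T_η»); Balaban1985BackgroundPropagators, (3.19) p.393, (3.23)–(3.25) p.394]
-/

noncomputable section

open NormedSpace
open Complex (I)

namespace Literature.MathematicalPhysics.QuantumFieldTheory.Balaban1983to89.B8LeafModelZd3SourceReality

open B7Prop1Explicit (e e_apply)
open B7Eq78Linearization (conjR conjR_apply QprimeIter zdBlocking)
open B8Ineq132 (covDeriv covDerivFwd InAk BondTouches)
open B7Prop2Explicit (unitaryUnits avgIter)
open B8Lemma1NonAbelian (mulCfg)
open B8Eq119TwistedAxial (bgT bgT_one Restr129 InAx inAx_self)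
open B8Eq138LandauZd (covDivB covLap qprimeT1 QprimeT QT InR138 IsLandau146W IsLandau146 logCfg)
open B8Eq191FlatStencils (covLap_flat_apply covDeriv_flat_apply QT_flat_apply QprimeIter_flat_eq_sum_of_supp)
open Literature.MathematicalPhysics.QuantumLattice (blockMap)
open B8LeafModelZd (ZdIdx)
open B8LeafModelZd3 (zdGF3)

-- `Site` alone could resolve to the torus sites of `Setup.lean`; re-export the `ℤ^d` sites of `B7Prop1Explicit`.
export B7Prop1Explicit (Site)

variable {d : ℕ}

/-! ## §1 Flat bookkeeping at `U₀ = 1`: the Laplacian of `c • 1`, `ℂ`-homogeneity, linearity, a crude norm bound, reality -/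

section Flat

variable {𝔸 : Type*} [NormedRing 𝔸] [NormedAlgebra ℂ 𝔸]

/-- **The flat Laplacian of a scalar multiple of `1`**: `Δ^η_1(c•1)(x) = (η⁻²Σ_μ(2c(x) − c(x+e_μ) − c(x−e_μ)))•1` — the real second-difference
stencil acting on the coefficient. [cite: Balaban1985BackgroundPropagators, (3.23) p.394; Balaban1985RegularSpaces, (1.1) p.76] -/
theorem covLap_flat_realSmul_one (η : ℝ) (c : Site d → ℝ) (x : Site d) :
    covLap η (1 : Site d → Fin d → 𝔸ˣ) (fun y => c y • (1 : 𝔸)) x =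
      ((η ^ 2)⁻¹ * ∑ μ : Fin d, (2 * c x - c (x + e μ) - c (x - e μ))) • (1 : 𝔸) := by
  rw [covLap_flat_apply, Finset.mul_sum, Finset.sum_smul]
  refine Finset.sum_congr rfl fun μ _ => ?_
  rw [smul_smul, ← sub_smul, ← sub_smul, smul_smul]

/-- **`ℂ`-homogeneity of the flat Laplacian**: `Δ^η_1(a•g) = a•Δ^η_1 g` (so `R(1)`, typed by `InR138`, is closed under `f ↦ I•f`).
[cite: Balaban1985BackgroundPropagators, (3.23) p.394; Balaban1985RegularSpaces, (1.146) p.101] -/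
theorem covLap_flat_constSmul (η : ℝ) (a : ℂ) (g : Site d → 𝔸) (x : Site d) :
    covLap η (1 : Site d → Fin d → 𝔸ˣ) (fun y => a • g y) x = a • covLap η (1 : Site d → Fin d → 𝔸ˣ) g x := by
  rw [covLap_flat_apply, covLap_flat_apply, Finset.smul_sum]
  refine Finset.sum_congr rfl fun μ _ => ?_
  rw [smul_comm (2 : ℝ) a, ← smul_sub, ← smul_sub, smul_comm ((η ^ 2)⁻¹) a]

/-- Additivity of the flat Laplacian: `Δ^η_1(g − h) = Δ^η_1 g − Δ^η_1 h`. [cite: Balaban1985BackgroundPropagators, (3.23) p.394] -/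
theorem covLap_flat_sub (η : ℝ) (g h : Site d → 𝔸) (x : Site d) :
    covLap η (1 : Site d → Fin d → 𝔸ˣ) (g - h) x =
      covLap η (1 : Site d → Fin d → 𝔸ˣ) g x - covLap η (1 : Site d → Fin d → 𝔸ˣ) h x := by
  rw [covLap_flat_apply, covLap_flat_apply, covLap_flat_apply, ← Finset.sum_sub_distrib]
  refine Finset.sum_congr rfl fun μ _ => ?_
  simp only [Pi.sub_apply, ← smul_sub]
  congr 1
  rw [smul_sub]
  abel

/-- A crude bound: `‖Δ^η_1 g(x)‖ ≤ d·η⁻²·4·sup‖g‖`. [cite: Balaban1985BackgroundPropagators, (3.23) p.394] -/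
theorem norm_covLap_flat_le (η : ℝ) {g : Site d → 𝔸} {M : ℝ} (hg : ∀ y, ‖g y‖ ≤ M) (x : Site d) :
    ‖covLap η (1 : Site d → Fin d → 𝔸ˣ) g x‖ ≤ d * ((η ^ 2)⁻¹ * (4 * M)) := by
  rw [covLap_flat_apply]
  have hM : 0 ≤ M := le_trans (norm_nonneg _) (hg x)
  calc ‖∑ μ : Fin d, (η ^ 2)⁻¹ • ((2 : ℝ) • g x - g (x + e μ) - g (x - e μ))‖
      ≤ ∑ μ : Fin d, ‖(η ^ 2)⁻¹ • ((2 : ℝ) • g x - g (x + e μ) - g (x - e μ))‖ := norm_sum_le _ _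
    _ ≤ ∑ _μ : Fin d, (η ^ 2)⁻¹ * (4 * M) := by
        refine Finset.sum_le_sum fun μ _ => ?_
        rw [norm_smul, Real.norm_eq_abs, abs_of_nonneg (by positivity)]
        refine mul_le_mul_of_nonneg_left ?_ (by positivity)
        calc ‖(2 : ℝ) • g x - g (x + e μ) - g (x - e μ)‖
            ≤ ‖(2 : ℝ) • g x‖ + ‖g (x + e μ)‖ + ‖g (x - e μ)‖ := norm_sub_le_of_le (norm_sub_le _ _) le_rfl
          _ ≤ 2 * M + M + M := by
              rw [norm_smul, Real.norm_eq_abs, abs_of_pos (by norm_num : (0:ℝ) < 2)]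
              exact add_le_add (add_le_add (mul_le_mul_of_nonneg_left (hg x) (by norm_num)) (hg _)) (hg _)
          _ = 4 * M := by ring
    _ = d * ((η ^ 2)⁻¹ * (4 * M)) := by rw [Finset.sum_const, Finset.card_univ, Fintype.card_fin, nsmul_eq_mul]

variable [StarRing 𝔸] [StarModule ℂ 𝔸]

/-- **`D^{η*}_1 A` is Hermitian for a Hermitian bond field** (flat divergence = real combination of values of `A`).
[cite: Balaban1985RegularSpaces, (1.1) p.76, (1.146) p.101 («Lie algebra valued»)] -/
theorem isSelfAdjoint_covDivB_flat (η : ℝ) {A : Site d → Fin d → 𝔸} (hA : ∀ y ν, IsSelfAdjoint (A y ν)) (x : Site d) :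
    IsSelfAdjoint (covDivB η (1 : Site d → Fin d → 𝔸ˣ) A x) := by
  unfold covDivB
  refine isSelfAdjoint_sum _ fun ν _ => ?_
  rw [covDeriv_flat_apply]
  exact (IsSelfAdjoint.all (η⁻¹ : ℝ)).smul ((hA _ ν).sub (hA x ν))

/-- **`Δ^η_1 g` is Hermitian for Hermitian `g`** (flat Laplacian = real stencil). [cite: Balaban1985BackgroundPropagators, (3.23) p.394] -/
theorem isSelfAdjoint_covLap_flat (η : ℝ) {g : Site d → 𝔸} (hg : ∀ y, IsSelfAdjoint (g y)) (x : Site d) :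
    IsSelfAdjoint (covLap η (1 : Site d → Fin d → 𝔸ˣ) g x) := by
  rw [covLap_flat_apply]
  refine isSelfAdjoint_sum _ fun μ _ => ?_
  exact (IsSelfAdjoint.all ((η ^ 2)⁻¹ : ℝ)).smul ((((IsSelfAdjoint.all (2 : ℝ)).smul (hg x)).sub (hg _)).sub (hg _))

end Flat

/-! ## §2 The flat scalar Laplacian: support, summation by parts on a finite set, the dipole -/

section Scalar

open Function (support)

variable {η : ℝ} {G : (Site d → ℝ) → Site d → ℝ}

/-- The real flat Laplacian `G` (letter with the stencil law `hG`) of a function supported in `S` is supported in `S` and its `±e_μ`-translates.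
[cite: Balaban1985BackgroundPropagators, (3.23) p.394] -/
theorem support_flatLap_subset [DecidableEq (Site d)]
    (hG : ∀ c x, G c x = (η ^ 2)⁻¹ * ∑ μ : Fin d, (2 * c x - c (x + e μ) - c (x - e μ)))
    {a : Site d → ℝ} {S : Finset (Site d)} (ha : support a ⊆ (S : Set (Site d))) :
    support (G a) ⊆ ((S ∪ Finset.univ.biUnion fun μ : Fin d => S.image (fun y => y - e μ) ∪ S.image (fun y => y + e μ) :
      Finset (Site d)) : Set (Site d)) := by
  intro x hx
  rw [Function.mem_support, hG] at hx
  by_contra h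
  rw [Finset.mem_coe, Finset.mem_union, not_or] at h
  have h1 : a x = 0 := by
    by_contra h1
    exact h.1 (ha (Function.mem_support.2 h1))
  have h2 : ∀ μ, a (x + e μ) = 0 := fun μ => by
    by_contra h2
    refine h.2 (Finset.mem_biUnion.2 ⟨μ, Finset.mem_univ _, Finset.mem_union.2 (Or.inl ?_)⟩)
    exact Finset.mem_image.2 ⟨x + e μ, ha (Function.mem_support.2 h2), add_sub_cancel_right x (e μ)⟩
  have h3 : ∀ μ, a (x - e μ) = 0 := fun μ => by
    by_contra h3
    refine h.2 (Finset.mem_biUnion.2 ⟨μ, Finset.mem_univ _, Finset.mem_union.2 (Or.inr ?_)⟩)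
    exact Finset.mem_image.2 ⟨x - e μ, ha (Function.mem_support.2 h3), sub_add_cancel x (e μ)⟩
  apply hx
  simp only [h1, h2, h3, mul_zero, sub_zero, Finset.sum_const_zero]

/-- The shift identity `Σ_x a(x)b(x + w) = Σ_x a(x − w)b(x)` for finitely supported sums on `ℤᵈ` (translation is a bijection). [folklore]
[cite: Balaban1985BackgroundPropagators, (3.23) p.394 (bookkeeping)] -/
theorem finsum_mul_shift (a b : Site d → ℝ) (w : Site d) :
    ∑ᶠ x, a x * b (x + w) = ∑ᶠ x, a (x - w) * b x := by
  have h := finsum_comp (g := fun x => a (x - w) * b x) (fun x => x + w) (Equiv.addRight w).bijective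
  simp only [add_sub_cancel_right] at h
  exact h

/-- The shift identity on a finite set `T` containing both supports. [folklore] [cite: Balaban1985BackgroundPropagators, (3.23) p.394 (bookkeeping)] -/
theorem sum_mul_shift_eq {a b : Site d → ℝ} {T : Finset (Site d)} (ha : support a ⊆ (T : Set (Site d)))
    (hb : support b ⊆ (T : Set (Site d))) (w : Site d) :
    ∑ x ∈ T, a x * b (x + w) = ∑ x ∈ T, a (x - w) * b x := by
  rw [← finsum_eq_sum_of_support_subset (fun x => a x * b (x + w)) ((Function.support_mul_subset_left _ _).trans ha),
    ← finsum_eq_sum_of_support_subset (fun x => a (x - w) * b x) ((Function.support_mul_subset_right _ _).trans hb)]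
  exact finsum_mul_shift a b w

/-- **FLAT SUMMATION BY PARTS**: `Σ_{x∈T} a(x)(G b)(x) = Σ_{x∈T} (G a)(x)b(x)` for real functions supported in the finite set `T` — the symmetry
of `Δ^η_1 = D^{η*}_1D^η_1` of [4] (3.23) read on `ℤᵈ` (print: the scalar product of `L²(Ω₀, 𝔤)`, (1.27) p. 80).
[cite: Balaban1985BackgroundPropagators, (3.23) p.394; Balaban1985RegularSpaces, (1.27) p.80] -/
theorem sum_mul_flatLap_comm
    (hG : ∀ c x, G c x = (η ^ 2)⁻¹ * ∑ μ : Fin d, (2 * c x - c (x + e μ) - c (x - e μ)))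
    {a b : Site d → ℝ} {T : Finset (Site d)} (ha : support a ⊆ (T : Set (Site d))) (hb : support b ⊆ (T : Set (Site d))) :
    ∑ x ∈ T, a x * G b x = ∑ x ∈ T, G a x * b x := by
  have eL : ∑ x ∈ T, a x * G b x = ∑ μ : Fin d, (η ^ 2)⁻¹ *
      (2 * ∑ x ∈ T, a x * b x - ∑ x ∈ T, a x * b (x + e μ) - ∑ x ∈ T, a x * b (x - e μ)) := by
    calc ∑ x ∈ T, a x * G b x
        = ∑ x ∈ T, ∑ μ : Fin d, (η ^ 2)⁻¹ * (2 * (a x * b x) - a x * b (x + e μ) - a x * b (x - e μ)) :=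
          Finset.sum_congr rfl fun x _ => by
            rw [hG, Finset.mul_sum, Finset.mul_sum]
            exact Finset.sum_congr rfl fun μ _ => by ring
      _ = _ := by
          rw [Finset.sum_comm]
          refine Finset.sum_congr rfl fun μ _ => ?_
          rw [← Finset.mul_sum, Finset.sum_sub_distrib, Finset.sum_sub_distrib, Finset.mul_sum]
  have eR : ∑ x ∈ T, G a x * b x = ∑ μ : Fin d, (η ^ 2)⁻¹ *
      (2 * ∑ x ∈ T, a x * b x - ∑ x ∈ T, a (x + e μ) * b x - ∑ x ∈ T, a (x - e μ) * b x) := by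
    calc ∑ x ∈ T, G a x * b x
        = ∑ x ∈ T, ∑ μ : Fin d, (η ^ 2)⁻¹ * (2 * (a x * b x) - a (x + e μ) * b x - a (x - e μ) * b x) :=
          Finset.sum_congr rfl fun x _ => by
            rw [hG, Finset.mul_sum, Finset.sum_mul]
            exact Finset.sum_congr rfl fun μ _ => by ring
      _ = _ := by
          rw [Finset.sum_comm]
          refine Finset.sum_congr rfl fun μ _ => ?_
          rw [← Finset.mul_sum, Finset.sum_sub_distrib, Finset.sum_sub_distrib, Finset.mul_sum]
  rw [eL, eR]
  refine Finset.sum_congr rfl fun μ _ => ?_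
  have h1 : ∑ x ∈ T, a x * b (x + e μ) = ∑ x ∈ T, a (x - e μ) * b x := sum_mul_shift_eq ha hb (e μ)
  have h2 : ∑ x ∈ T, a x * b (x - e μ) = ∑ x ∈ T, a (x + e μ) * b x := by
    have h := sum_mul_shift_eq ha hb (-e μ)
    simp only [← sub_eq_add_neg, sub_neg_eq_add] at h
    exact h
  rw [h1, h2]
  ring

/-- **THE DIPOLE INEQUALITY**: for `c = r(δ₀ − δ_{e_μ₀})`, `r > 0`, `η ≠ 0`: `0 < (G(Gc))(0) − (G(Gc))(e_μ₀)` — by summation by parts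
`r·((G(Gc))(0) − (G(Gc))(e_μ₀)) = Σ_x (Gc)(x)² ≥ (Gc)(0)² = ((2d+1)rη⁻²)² > 0`.  (The scalar core of the refutation: `Σ|Δλ₀|² ≠ 0`.)
[cite: Balaban1985BackgroundPropagators, (3.23) p.394; Balaban1985RegularSpaces, (1.27) p.80] -/
theorem flatLap_dipole_pos [DecidableEq (Site d)] (hη : η ≠ 0)
    (hG : ∀ c x, G c x = (η ^ 2)⁻¹ * ∑ μ : Fin d, (2 * c x - c (x + e μ) - c (x - e μ)))
    {r : ℝ} (hr : 0 < r) (μ₀ : Fin d) {c : Site d → ℝ}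
    (hc : c = fun x => if x = 0 then r else if x = e μ₀ then -r else 0) :
    0 < G (G c) 0 - G (G c) (e μ₀) := by
  have hd : 0 < d := Fin.pos μ₀
  -- geometry of the two sites
  have heμ : ∀ μ : Fin d, e μ μ = 1 := fun μ => by rw [e_apply, if_pos rfl]
  have he0 : ∀ μ : Fin d, e μ ≠ (0 : Site d) := fun μ h => by
    have h1 := congrArg (fun x : Site d => x μ) h
    rw [heμ, Pi.zero_apply] at h1
    exact one_ne_zero h1
  have hne : (0 : Site d) ≠ e μ₀ := (he0 μ₀).symm
  have hee : ∀ μ : Fin d, e μ = e μ₀ ↔ μ = μ₀ := fun μ => by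
    refine ⟨fun h => ?_, fun h => by rw [h]⟩
    have h1 := congrArg (fun x : Site d => x μ) h
    rw [heμ, e_apply] at h1
    by_contra hμ
    rw [if_neg hμ] at h1
    exact one_ne_zero h1
  have hne' : ∀ μ : Fin d, -e μ ≠ e μ₀ := fun μ h => by
    have h1 := congrArg (fun x : Site d => x μ) h
    rw [Pi.neg_apply, heμ, e_apply] at h1
    by_cases hμ : μ = μ₀
    · rw [if_pos hμ] at h1; linarith
    · rw [if_neg hμ] at h1; linarith
  have hne0' : ∀ μ : Fin d, -e μ ≠ (0 : Site d) := fun μ h => he0 μ (neg_eq_zero.1 h)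
  -- values of the dipole
  have hc0 : c 0 = r := by rw [hc]; simp
  have hcp : ∀ μ : Fin d, c (0 + e μ) = if μ = μ₀ then -r else 0 := fun μ => by
    rw [zero_add, hc]
    simp only [he0 μ, if_false, hee μ]
  have hcm : ∀ μ : Fin d, c (0 - e μ) = 0 := fun μ => by
    rw [zero_sub, hc]
    simp only [hne0' μ, if_false, hne' μ]
  -- the value of `G c` at the origin
  have hG0 : G c 0 = (η ^ 2)⁻¹ * ((2 * d + 1) * r) := by
    rw [hG]
    congr 1
    simp_rw [hc0, hcp, hcm, sub_zero]
    rw [Finset.sum_sub_distrib, Finset.sum_const, Finset.card_univ, Fintype.card_fin, nsmul_eq_mul,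
      Finset.sum_ite_eq' Finset.univ μ₀ (fun _ => -r), if_pos (Finset.mem_univ _)]
    ring
  have hG0ne : G c 0 ≠ 0 := by
    rw [hG0]
    have : (0 : ℝ) < (2 * d + 1) * r := by positivity
    exact mul_ne_zero (inv_ne_zero (pow_ne_zero 2 hη)) this.ne'
  -- supports
  set S : Finset (Site d) := {0, e μ₀} with hS
  have hcs : support c ⊆ (S : Set (Site d)) := by
    intro x hx
    rw [Function.mem_support, hc] at hx
    simp only [hS, Finset.coe_insert, Finset.coe_singleton, Set.mem_insert_iff, Set.mem_singleton_iff]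
    by_contra h
    rw [not_or] at h
    simp only [h.1, h.2, if_false, ne_eq, not_true_eq_false] at hx
  set T : Finset (Site d) := S ∪ Finset.univ.biUnion fun μ : Fin d => S.image (fun y => y - e μ) ∪ S.image (fun y => y + e μ)
    with hT
  have hST : (S : Set (Site d)) ⊆ (T : Set (Site d)) := by
    rw [hT]; exact_mod_cast Finset.subset_union_left
  have hcT : support c ⊆ (T : Set (Site d)) := hcs.trans hST
  have hGT : support (G c) ⊆ (T : Set (Site d)) := by rw [hT]; exact support_flatLap_subset hG hcs
  have h0T : (0 : Site d) ∈ T := hST (by simp [hS])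
  -- summation by parts: `r·(G(Gc)(0) − G(Gc)(e μ₀)) = Σ_T (G c)²`
  have key := sum_mul_flatLap_comm hG hcT hGT
  have lhs : ∑ x ∈ T, c x * G (G c) x = r * (G (G c) 0 - G (G c) (e μ₀)) := by
    rw [← finsum_eq_sum_of_support_subset (fun x => c x * G (G c) x) ((Function.support_mul_subset_left _ _).trans hcT)]
    rw [finsum_eq_sum_of_support_subset (fun x => c x * G (G c) x) ((Function.support_mul_subset_left _ _).trans hcs),
      hS, Finset.sum_pair hne, hc]
    simp only [if_true, he0 μ₀, if_false]
    ring
  have rhs : 0 < ∑ x ∈ T, G c x * G c x :=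
    lt_of_lt_of_le (mul_self_pos.2 hG0ne) (Finset.single_le_sum (fun x _ => mul_self_nonneg (G c x)) h0T)
  rw [key] at lhs
  nlinarith [lhs, rhs, hr]

end Scalar

/-! ## §3 THE REFUTATION: Theorem 8's surviving form is FALSE at every `zdGF3` family containing an all-`ℤᵈ` LamTop member,
because the typed source space forgets «Lie algebra valued» -/

section Refutation

variable {𝔸 : Type} [CStarAlgebra 𝔸] [Nontrivial 𝔸]

omit [Nontrivial 𝔸] in
/-- **At an all-`ℤᵈ` LamTop member the multiplier term cannot see inside a block**: with `Λ_j = {j = k}` (`k ≥ 1`) the flat transpose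
`Q′(1)ᵀμ` (`B8Eq191FlatStencils.QT_flat_apply`: level-`j` term = `L^{−dj}(𝟙_{Λ_j}μ_j)(y_j(x))`) takes the same value at `0` and at `e_μ₀` — the
level-`0` term is `𝟙_∅`, and for `j ≥ 1` both sites lie in the `Lʲ`-block of `0` (`L ≥ 2`). [cite: Balaban1985BackgroundPropagators, (3.19) p.393, (3.24) p.394; Balaban1985RegularSpaces, (1.29) p.81] -/
theorem QT_flat_lamTop_eq {L : ℕ} (hL : 2 ≤ L) {k : ℕ} (hk : 1 ≤ k) {Λ : ℕ → Set (Site d)}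
    (hΛ : ∀ j, Λ j = {_y | j = k}) (μ : ℕ → Site d → 𝔸) (μ₀ : Fin d) :
    QT L k Λ (1 : Site d → Fin d → 𝔸ˣ) μ 0 = QT L k Λ (1 : Site d → Fin d → 𝔸ˣ) μ (e μ₀) := by
  rw [QT_flat_apply, QT_flat_apply]
  refine Finset.sum_congr rfl fun j _ => ?_
  rcases Nat.eq_zero_or_pos j with rfl | hjpos
  · have h0 : Λ 0 = ∅ := by
      rw [hΛ]; ext y; simp only [Set.mem_setOf_eq, Set.mem_empty_iff_false, iff_false]; omega
    simp only [h0, Set.indicator_empty]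
  · have hM : 2 ≤ L ^ j := le_trans hL (Nat.le_self_pow hjpos.ne' L)
    have hb : blockMap (L ^ j) (e μ₀) = blockMap (L ^ j) (0 : Site d) := by
      funext i
      rw [B7BlockGeometry.blockMap_apply, B7BlockGeometry.blockMap_apply, e_apply, Pi.zero_apply, Int.zero_ediv]
      split_ifs
      · exact Int.ediv_eq_zero_of_lt (by norm_num) (by exact_mod_cast hM)
      · exact Int.zero_ediv _
    rw [hb]

/-- `z•1` Hermitian in a nontrivial C⋆-algebra forces `z` real (`Im z = 0`). [folklore] [cite: Balaban1985RegularSpaces, (1.146) p.101 (bookkeeping: «Lie algebra valued»)] -/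
theorem star_smul_one_eq {z : ℂ} (h : IsSelfAdjoint (z • (1 : 𝔸))) : z.im = 0 := by
  have h1 : star (z • (1 : 𝔸)) = z • 1 := h.star_eq
  rw [star_smul, star_one] at h1
  have h2 : (star z - z) • (1 : 𝔸) = 0 := by rw [sub_smul, h1, sub_self]
  rcases smul_eq_zero.1 h2 with h3 | h3
  · exact Complex.conj_eq_iff_im.1 (sub_eq_zero.1 h3)
  · exact absurd h3 one_ne_zero

/-- ★ **THEOREM 8's SURVIVING FORM IS FALSE at `zdGF3` on every family whose index map hits an all-`ℤᵈ` LamTop member** (`Ω_j = ℤᵈ` for all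
`j`, `Λs m j = {j = m}`; `d ≥ 2`, `L ≥ 2`; every `β, len, γ > 0, B₁, B₂`).  Datum: `α₀ = α₁ = c₁/2`, `U₀ = U′ = 1` ((1.33) by `one_inAk`, (1.34)
by `inAx_self`, (1.35) trivially), source `f = Δ^η_1(I•λ₀)`, `λ₀ = r(δ₀ − δ_{e₀})•1` (`f ∈ R(1)`: zero block sums at every level `≥ 1`;
`|f|₍₋₂₎ ≤ γ(α₀+α₁)/2` for `r` small).  From the conclusion: `A′ = (1/iη) log 1^{u}` Hermitian on all bonds ((1.62)-clause, `Ω₀ = ℤᵈ`), and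
(1.146) `Δ(D^{η*}_1A′ − f) = Q′(1)ᵀμ`; evaluating at `0` and `e₀` and subtracting, `QT_flat_lamTop_eq` kills `μ`, the `D^{η*}_1A′`-part is
Hermitian, the `f`-part is `I•κ•1` with `κ > 0` (`flatLap_dipole_pos`) — contradiction (`star_smul_one_eq`).
[cite: Balaban1985RegularSpaces, Thm 8 (1.146) p.101 («Lie algebra valued»), (1.62) p.87, (1.33)–(1.35) p.82, (1.29) p.81, p.77 («Ω_j = T_η»); Balaban1985BackgroundPropagators, (3.19)–(3.25) pp.393–394] -/
theorem not_thm8SurvivingAt_zdGF3_lamTop (hd2 : 2 ≤ d) {L : ℕ} (hL : 2 ≤ L) (β : ℝ) (len : Site d → ℝ)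
    {γ : ℝ} (hγ : 0 < γ) (B₁ B₂ : ℝ) {J : Type} (ι : J → ZdIdx d L) (a : J)
    (hΩ : ∀ j, (ι a).Ω j = Set.univ) (hΛ : ∀ m j, (ι a).Λs m j = {_y | j = m}) :
    ¬ B8Thm8Surviving.Thm8SurvivingAt γ B₁ B₂ (fun j : J => zdGF3 𝔸 L β len (ι j)) := by
  rintro ⟨c₁, hc₁, H⟩
  classical
  have hL1 : 1 ≤ L := le_trans (by norm_num) hL
  have hd0 : 0 < d := by omega
  set i : ZdIdx d L := ι a with hi
  have hη := i.hη
  have hk := i.hk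
  set μ₀ : Fin d := ⟨0, hd0⟩ with hμ₀
  -- the smallness parameters
  set α : ℝ := c₁ / 2 with hα_def
  have hα : 0 < α := by positivity
  have hαc : α + α ≤ c₁ := by rw [hα_def]; linarith
  -- the data `U₀ = U′ = 1`
  have h1u : ∀ x κ, (1 : Site d → Fin d → 𝔸ˣ) x κ ∈ unitaryUnits 𝔸 := fun _ _ => (unitaryUnits 𝔸).one_mem
  let U₀ : (zdGF3 𝔸 L β len i).Cfg := ⟨1, h1u⟩
  let P : (zdGF3 𝔸 L β len i).Pert := (⟨1, h1u⟩, ⟨1, h1u⟩)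
  have hmul : mulCfg (1 : Site d → Fin d → 𝔸ˣ) (1 : Site d → Fin d → 𝔸ˣ) = 1 := by
    rw [B8Thm4Concrete.mulCfg_eq_mul, mul_one]
  have hInA : (zdGF3 𝔸 L β len i).InA α U₀ := B8Prop6OfThm4.one_inAk hL1 i.k hη hα _
  have hInAAx : (zdGF3 𝔸 L β len i).InAAx α U₀ P := by
    refine ⟨rfl, ?_, ?_⟩
    · show InAk L i.k i.η α i.Ω (mulCfg 1 1)
      rw [hmul]
      exact B8Prop6OfThm4.one_inAk hL1 i.k hη hα _
    · intro m _
      show InAx L m (i.Λs m) 1 (mulCfg 1 1)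
      rw [hmul]
      exact inAx_self L m (i.Λs m) 1
  have havg : (zdGF3 𝔸 L β len i).avgClose α U₀ P := by
    intro j _ z μ _
    show ‖(avgIter L (mulCfg (1 : Site d → Fin d → 𝔸ˣ) 1) j z μ : 𝔸) - (avgIter L (1 : Site d → Fin d → 𝔸ˣ) j z μ : 𝔸)‖ ≤ α
    rw [hmul, sub_self, norm_zero]
    exact hα.le
  -- the flat scalar Laplacian as a letter, and the crude norm constant
  set G : (Site d → ℝ) → Site d → ℝ := fun c x => (i.η ^ 2)⁻¹ * ∑ μ : Fin d, (2 * c x - c (x + e μ) - c (x - e μ)) with hG_def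
  have hG : ∀ c x, G c x = (i.η ^ 2)⁻¹ * ∑ μ : Fin d, (2 * c x - c (x + e μ) - c (x - e μ)) := fun _ _ => rfl
  set K₀ : ℝ := d * ((i.η ^ 2)⁻¹ * 4) with hK₀_def
  have hK₀ : 0 ≤ K₀ := by positivity
  have hK₀' : K₀ ≤ K₀ * K₀ + 1 := by nlinarith [sq_nonneg (K₀ - 1)]
  -- the amplitude `r`: so small that `|f|₍₋₂₎ ≤ γ(α+α)/2`
  set cN : ℝ := γ * (α + α) / 2 with hcN
  have hcN0 : 0 < cN := by positivity
  set wk : ℝ := (((L : ℝ) ^ i.k * i.η) ^ (-(2 : ℝ))) with hwk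
  have hwk0 : 0 < wk := Real.rpow_pos_of_pos (by positivity) _
  set r : ℝ := cN * wk / (K₀ * K₀ + 1) with hr_def
  have hr : 0 < r := by positivity
  -- the dipole, the imaginary source
  set c : Site d → ℝ := fun x => if x = 0 then r else if x = e μ₀ then -r else 0 with hc_def
  set lamI : Site d → 𝔸 := fun x => (I : ℂ) • (c x • (1 : 𝔸)) with hlamI
  set f : Site d → 𝔸 := covLap i.η (1 : Site d → Fin d → 𝔸ˣ) lamI with hf_def
  have hcabs : ∀ x, |c x| ≤ r := fun x => by
    simp only [hc_def]
    split_ifs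
    · exact (abs_of_pos hr).le
    · rw [abs_neg]; exact (abs_of_pos hr).le
    · rw [abs_zero]; exact hr.le
  have hlam_norm : ∀ x, ‖lamI x‖ ≤ r := fun x => by
    simp only [hlamI]
    rw [norm_smul, Complex.norm_I, one_mul, norm_smul, norm_one, mul_one, Real.norm_eq_abs]
    exact hcabs x
  -- geometry: `0 ≠ e μ₀`, both in the same `Lʲ`-block for `j ≥ 1`
  have heμ : e μ₀ μ₀ = 1 := by rw [e_apply, if_pos rfl]
  have hne : (0 : Site d) ≠ e μ₀ := fun h => by
    have h1 := congrArg (fun x : Site d => x μ₀) h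
    rw [heμ, Pi.zero_apply] at h1
    exact zero_ne_one h1
  have hblock : ∀ j, 1 ≤ j → blockMap (L ^ j) (e μ₀) = blockMap (L ^ j) (0 : Site d) := fun j hj => by
    have hM : 2 ≤ L ^ j := le_trans hL (Nat.le_self_pow (by omega) L)
    funext ii
    rw [B7BlockGeometry.blockMap_apply, B7BlockGeometry.blockMap_apply, e_apply, Pi.zero_apply, Int.zero_ediv]
    split_ifs
    · exact Int.ediv_eq_zero_of_lt (by norm_num) (by exact_mod_cast hM)
    · exact Int.zero_ediv _
  -- `f ∈ R(1)`: the witness `I•λ₀` has zero block averages at every level `j ≥ 1`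
  have hlam_supp : ∀ w, w ∉ ({0, e μ₀} : Finset (Site d)) → lamI w = 0 := fun w hw => by
    rw [Finset.mem_insert, Finset.mem_singleton, not_or] at hw
    simp only [hlamI, hc_def, hw.1, hw.2, if_false, zero_smul, smul_zero]
  have hInR : (zdGF3 𝔸 L β len i).InR U₀ f := by
    refine ⟨lamI, fun j hj y hy => ?_, fun x _ => by rw [hΩ 0, Set.indicator_univ]⟩
    rw [hΛ] at hy
    have hjk : j = i.k := hy
    rw [hΩ 0, Set.indicator_univ,
      QprimeIter_flat_eq_sum_of_supp hL1 {0, e μ₀} lamI hlam_supp j y, Finset.sum_pair hne,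
      hblock j (by omega), ← smul_add]
    have : lamI 0 + lamI (e μ₀) = 0 := by
      simp only [hlamI, hc_def, if_true, (hne.symm : e μ₀ ≠ 0), if_false]
      rw [← smul_add, ← add_smul, add_neg_cancel, zero_smul, smul_zero]
    rw [this, smul_zero]
  -- `|f|₍₋₂₎ < γ(α + α)`
  have hf_norm : ∀ x, ‖f x‖ ≤ K₀ * r := fun x =>
    (norm_covLap_flat_le i.η hlam_norm x).trans (le_of_eq (by rw [hK₀_def]; ring))
  have hfN : (zdGF3 𝔸 L β len i).fNorm f < γ * (α + α) := by
    have hle : (zdGF3 𝔸 L β len i).fNorm f ≤ cN := by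
      refine B8ScaledSupNorm.msup_le_of_pointwise hL1 hη hcN0.le fun j hj x _ => ?_
      have hwj : wk ≤ ((L : ℝ) ^ j * i.η) ^ (-(2 : ℝ)) := by
        rw [hwk]
        refine Real.rpow_le_rpow_of_nonpos (by positivity) ?_ (by norm_num)
        exact mul_le_mul_of_nonneg_right (pow_le_pow_right₀ (by exact_mod_cast hL1) hj) hη.le
      calc ‖f x‖ ≤ K₀ * r := hf_norm x
        _ ≤ cN * wk := by
            rw [hr_def]
            have h1 : K₀ * (cN * wk) ≤ (K₀ * K₀ + 1) * (cN * wk) :=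
              mul_le_mul_of_nonneg_right hK₀' (mul_pos hcN0 hwk0).le
            calc K₀ * (cN * wk / (K₀ * K₀ + 1)) = K₀ * (cN * wk) / (K₀ * K₀ + 1) := by ring
              _ ≤ cN * wk := by rw [div_le_iff₀ (by positivity)]; linarith
        _ ≤ cN * ((L : ℝ) ^ j * i.η) ^ (-(2 : ℝ)) := mul_le_mul_of_nonneg_left hwj hcN0.le
    have : cN < γ * (α + α) := by rw [hcN]; linarith [mul_pos hγ (by linarith : 0 < α + α)]
    exact lt_of_le_of_lt hle this
  -- THEOREM 8's surviving conclusion at this datum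
  obtain ⟨u, -, ⟨h162, -, h146, -⟩, -⟩ := H a α α hα hα hαc U₀ P f hInA trivial hInAAx havg hInR hfN
  -- the gauge-fixed exponent field `A′` is Hermitian on every bond (the (1.62)-clause at `j = 0`, `Ω₀ = ℤᵈ`)
  set W : Site d → Fin d → 𝔸ˣ := ((zdGF3 𝔸 L β len i).act P u).2.1 with hW
  have hsa : ∀ y τ, IsSelfAdjoint (logCfg i.η W y τ) := fun y τ => by
    have hmem : (y, τ) ∈ {b : Site d × Fin d | B8Eq140Level.SideTouches (i.Ω 0) b.1 b.2} := by
      rw [Set.mem_setOf_eq, hΩ 0]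
      haveI : Nontrivial (Fin d) := Fin.nontrivial_iff_two_le.mpr hd2
      obtain ⟨κ, hκ⟩ := exists_ne τ
      exact B8Eq140Level.sideTouches_of_bondTouches hκ (Or.inl (Set.mem_univ _))
    exact (h162 0 (Nat.zero_le _) (y, τ) hmem).2.1
  -- (1.146) in multiplier form on `Ω₀ = ℤᵈ`
  obtain ⟨-, μ, hμ⟩ := h146
  have hE : ∀ x, covLap i.η (1 : Site d → Fin d → 𝔸ˣ) (covDivB i.η (1 : Site d → Fin d → 𝔸ˣ) (logCfg i.η W) - f) x =
      QT L i.k (i.Λs i.k) (1 : Site d → Fin d → 𝔸ˣ) μ x := fun x => by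
    have h := hμ x (by rw [hΩ 0]; exact Set.mem_univ x)
    rwa [hΩ 0, Set.indicator_univ] at h
  -- evaluate at `0` and at `e μ₀` and subtract: the multiplier terms cancel
  set D : Site d → 𝔸 := covLap i.η (1 : Site d → Fin d → 𝔸ˣ) (covDivB i.η (1 : Site d → Fin d → 𝔸ˣ) (logCfg i.η W)) with hD
  set F : Site d → 𝔸 := covLap i.η (1 : Site d → Fin d → 𝔸ˣ) f with hF
  have hQT := QT_flat_lamTop_eq (𝔸 := 𝔸) hL hk (fun j => hΛ i.k j) μ μ₀
  have hdiff : D 0 - D (e μ₀) = F 0 - F (e μ₀) := by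
    have h0 := hE 0
    have h1 := hE (e μ₀)
    rw [covLap_flat_sub] at h0 h1
    have : (D 0 - F 0) - (D (e μ₀) - F (e μ₀)) = 0 := by
      show (covLap i.η 1 (covDivB i.η 1 (logCfg i.η W)) 0 - covLap i.η 1 f 0) -
          (covLap i.η 1 (covDivB i.η 1 (logCfg i.η W)) (e μ₀) - covLap i.η 1 f (e μ₀)) = 0
      rw [h0, h1, hQT, sub_self]
    rw [← sub_eq_zero]
    rw [← this]
    abel
  -- the left side is Hermitian
  have hDsa : IsSelfAdjoint (D 0 - D (e μ₀)) :=
    (isSelfAdjoint_covLap_flat i.η (isSelfAdjoint_covDivB_flat i.η hsa) 0).sub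
      (isSelfAdjoint_covLap_flat i.η (isSelfAdjoint_covDivB_flat i.η hsa) (e μ₀))
  -- the right side is `I • κ • 1`, `κ = G(Gc)(0) − G(Gc)(e μ₀) > 0`
  have hF1 : ∀ x, covLap i.η (1 : Site d → Fin d → 𝔸ˣ) lamI x = (I : ℂ) • (G c x • (1 : 𝔸)) := fun x => by
    rw [hlamI, covLap_flat_constSmul, covLap_flat_realSmul_one]
  have hF2 : ∀ x, F x = (I : ℂ) • (G (G c) x • (1 : 𝔸)) := fun x => by
    rw [hF, hf_def, show covLap i.η (1 : Site d → Fin d → 𝔸ˣ) lamI = fun y => (I : ℂ) • (G c y • (1 : 𝔸)) from funext hF1,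
      covLap_flat_constSmul, covLap_flat_realSmul_one]
  set κ : ℝ := G (G c) 0 - G (G c) (e μ₀) with hκ
  have hκpos : 0 < κ := flatLap_dipole_pos hη.ne' hG hr μ₀ rfl
  have hFκ : F 0 - F (e μ₀) = ((I * (κ : ℂ)) : ℂ) • (1 : 𝔸) := by
    rw [hF2, hF2, ← smul_sub, ← sub_smul, ← Complex.coe_smul, smul_smul]
  -- contradiction: `I·κ` would have to be real
  have him : (I * (κ : ℂ)).im = 0 := star_smul_one_eq (𝔸 := 𝔸) (by rw [← hFκ, ← hdiff]; exact hDsa)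
  simp only [Complex.mul_im, Complex.I_re, Complex.I_im, Complex.ofReal_re, Complex.ofReal_im, zero_mul, one_mul,
    zero_add] at him
  exact hκpos.ne' him

/-- **The `Ω₀ = ℤᵈ` sub-family of this seat's g4 `B8Thm8SurvivingZd3.thm8SurvivingAt_zd3_univ_lan`**: for `d ≥ 2`, `L ≥ 2`, every `β, len, γ > 0,
B₁, B₂`: `¬ Thm8SurvivingAt γ B₁ B₂ (fun i : {i : ZdIdx d L // i.Ω 0 = univ} => zdGF3 𝔸 L β len i.1)` — so the five sourced sockets of that
theorem (`SP5base`, `SP5`, `SH59src`, `SP5u`, `SP3src`) are JOINTLY UNSATISFIABLE for every admissible `LanF` (the theorem is valid; its conclusion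
is false). [cite: Balaban1985RegularSpaces, Thm 8 (1.146) p.101 («Lie algebra valued»), p.77 («Ω_j = T_η»)] -/
theorem not_thm8SurvivingAt_zdGF3_univ (hd2 : 2 ≤ d) {L : ℕ} (hL : 2 ≤ L) (β : ℝ) (len : Site d → ℝ) {γ : ℝ} (hγ : 0 < γ)
    (B₁ B₂ : ℝ) :
    ¬ B8Thm8Surviving.Thm8SurvivingAt γ B₁ B₂ (fun i : {i : ZdIdx d L // i.Ω 0 = Set.univ} => zdGF3 𝔸 L β len i.1) := by
  have hL1 : 1 ≤ L := le_trans (by norm_num) hL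
  obtain ⟨i, h0, -, -, hΩ, hΛ, -⟩ := B8LeafModelZd3NonVacuity.exists_member_univ (d := d) hL1 (k := 1) le_rfl one_pos
  exact not_thm8SurvivingAt_zdGF3_lamTop hd2 hL β len hγ B₁ B₂ (fun j : {i : ZdIdx d L // i.Ω 0 = Set.univ} => j.1) ⟨i, h0⟩ hΩ hΛ

end Refutation

/-! ## §4 AT NODE 00's RECORD: the family of record, its three- and four-law sub-families, and the [B8] slots of record -/

section Record

open Node00 (Stage3Params IdxB8 famB8OfRecord ResidB8 B8LeafOfRecord IdxB8Sub famB8OfRecordSub B8LeafOfRecordSub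
  idxB8Laws_of_member_univ B8LeafOfRecordSubB)
open B8IdxB8LawsB (IdxB8SubB famB8OfRecordSubB idxB8LawsB_of_member_univ)
open B8LeafKnitRS (B8LeafRS)

/-- **At NODE 00's family of record** `Node00.famB8OfRecord θ β len` (index `IdxB8 θ = {i // i.Ω 0 = univ}`, `θ.D ≥ 2`): Theorem 8's surviving form is
FALSE for every `γ > 0`, `B₁, B₂` (the LamTop member of depth `1` at `η = L⁻¹`). [cite: Balaban1985RegularSpaces, Thm 8 (1.146) p.101, p.77] -/
theorem not_thm8SurvivingAt_famB8OfRecord (θ : Stage3Params) (hD : 2 ≤ θ.D) (β : ℝ) (len : Site θ.D → ℝ)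
    {γ : ℝ} (hγ : 0 < γ) (B₁ B₂ : ℝ) :
    ¬ B8Thm8Surviving.Thm8SurvivingAt γ B₁ B₂ (famB8OfRecord θ β len) := by
  have hL : 2 ≤ θ.L := θ.two_le_L
  have hL1 : 1 ≤ θ.L := le_trans (by norm_num) hL
  have hη : (0 : ℝ) < ((θ.L : ℝ)⁻¹) ^ 1 := pow_pos (inv_pos.mpr (by exact_mod_cast (show 0 < θ.L by omega))) 1
  obtain ⟨i, h0, -, -, hΩ, hΛ, -⟩ := B8LeafModelZd3NonVacuity.exists_member_univ (d := θ.D) hL1 (k := 1) le_rfl hη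
  exact not_thm8SurvivingAt_zdGF3_lamTop hD hL β len hγ B₁ B₂ (fun j : IdxB8 θ => j.1) ⟨i, h0⟩ hΩ hΛ

/-- **At the three-law sub-family of record** `Node00.famB8OfRecordSub θ β len` (`IdxB8Sub θ`; the member obeys the laws by `idxB8Laws_of_member_univ`):
Theorem 8's surviving form is FALSE for every `γ > 0`, `B₁, B₂`. [cite: Balaban1985RegularSpaces, Thm 8 (1.146) p.101, (1.6) p.77] -/
theorem not_thm8SurvivingAt_famB8OfRecordSub (θ : Stage3Params) (hD : 2 ≤ θ.D) (β : ℝ) (len : Site θ.D → ℝ)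
    {γ : ℝ} (hγ : 0 < γ) (B₁ B₂ : ℝ) :
    ¬ B8Thm8Surviving.Thm8SurvivingAt γ B₁ B₂ (famB8OfRecordSub θ β len) := by
  have hL : 2 ≤ θ.L := θ.two_le_L
  have hL1 : 1 ≤ θ.L := le_trans (by norm_num) hL
  have hη : (0 : ℝ) < ((θ.L : ℝ)⁻¹) ^ 1 := pow_pos (inv_pos.mpr (by exact_mod_cast (show 0 < θ.L by omega))) 1
  obtain ⟨i, h0, hik, hiη, hΩ, hΛ, -⟩ := B8LeafModelZd3NonVacuity.exists_member_univ (d := θ.D) hL1 (k := 1) le_rfl hη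
  exact not_thm8SurvivingAt_zdGF3_lamTop hD hL β len hγ B₁ B₂ (fun j : IdxB8Sub θ => j.1.1)
    ⟨⟨i, h0⟩, idxB8Laws_of_member_univ hL1 (by rw [hiη, hik]) hΛ⟩ hΩ hΛ

/-- **At the four-law sub-family of record** `B8IdxB8LawsB.famB8OfRecordSubB θ β len` (`IdxB8SubB θ`, the index of the N05 knits of record;
the member obeys the bond law by `idxB8LawsB_of_member_univ`): Theorem 8's surviving form is FALSE for every `γ > 0`, `B₁, B₂`.
[cite: Balaban1985RegularSpaces, Thm 8 (1.146) p.101, (1.12) p.78, p.77] -/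
theorem not_thm8SurvivingAt_famB8OfRecordSubB (θ : Stage3Params) (hD : 2 ≤ θ.D) (β : ℝ) (len : Site θ.D → ℝ)
    {γ : ℝ} (hγ : 0 < γ) (B₁ B₂ : ℝ) :
    ¬ B8Thm8Surviving.Thm8SurvivingAt γ B₁ B₂ (famB8OfRecordSubB θ β len) := by
  have hL : 2 ≤ θ.L := θ.two_le_L
  have hL1 : 1 ≤ θ.L := le_trans (by norm_num) hL
  have hη : (0 : ℝ) < ((θ.L : ℝ)⁻¹) ^ 1 := pow_pos (inv_pos.mpr (by exact_mod_cast (show 0 < θ.L by omega))) 1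
  obtain ⟨i, h0, hik, hiη, hΩ, hΛ, hΛb⟩ := B8LeafModelZd3NonVacuity.exists_member_univ (d := θ.D) hL1 (k := 1) le_rfl hη
  exact not_thm8SurvivingAt_zdGF3_lamTop hD hL β len hγ B₁ B₂ (fun j : IdxB8SubB θ => j.1.1)
    ⟨⟨i, h0⟩, idxB8LawsB_of_member_univ hL1 (by rw [hiη, hik]) hΩ hΛ hΛb⟩ hΩ hΛ

/-- **No surviving [B8] leaf over `famB8OfRecordSubB`**: `B8LeafKnitRS.B8LeafRS … (famB8OfRecordSubB θ β len) …` is FALSE for EVERY parameter set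
(`d, L, C₂, B₁′, B₀′, B₁, B₂, c₁, inp, B₀β`) and EVERY `loc ∕ lan ∕ cub ∕ toAxial` — its conjunct `t8` is refuted.  Hence every knit concluding it
(or `∃ c₁ > 0, B8LeafRS …`) has jointly unsatisfiable hypotheses. [cite: Balaban1985RegularSpaces, Lemma 1 – Thm 8 pp.79–101 (the typed leaf), Thm 8 p.101] -/
theorem not_b8LeafRS_famB8OfRecordSubB (θ : Stage3Params) (hD : 2 ≤ θ.D) (β : ℝ) (len : Site θ.D → ℝ)
    {I₁ I₃ I₄ : Type} (dd : ℕ) (L C₂ B₁' B₀' B₁ B₂ c₁ : ℝ) (inp : B8.B9Inputs) (B₀β : ℝ)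
    (loc : I₁ → B8.LocalData) (lan : I₃ → B8.LandauData) (cub : I₄ → B8.CubeData)
    (toAxial : ∀ j, (famB8OfRecordSubB θ β len j).Cfg → (famB8OfRecordSubB θ β len j).Pert → (famB8OfRecordSubB θ β len j).Pert) :
    ¬ B8LeafRS dd L C₂ B₁' B₀' B₁ B₂ c₁ inp B₀β loc (famB8OfRecordSubB θ β len) lan cub toAxial := fun h =>
  not_thm8SurvivingAt_famB8OfRecordSubB θ hD β len one_pos B₁ B₂ h.t8

/-- ★★ **NODE 00's [B8] SLOT OF RECORD IS UNINHABITED**: `¬ Node00.B8LeafOfRecord θ λ` for every `θ` with `θ.D ≥ 2` and every residual layer `λ`.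
[cite: Balaban1985RegularSpaces, Lemma 1 – Thm 8 pp.79–101 (the typed leaf), Thm 8 (1.146) p.101] -/
theorem not_b8LeafOfRecord (θ : Stage3Params) (hD : 2 ≤ θ.D) (lam : ResidB8 θ) : ¬ B8LeafOfRecord θ lam := fun h =>
  not_thm8SurvivingAt_famB8OfRecord θ hD lam.β lam.len one_pos lam.B₁ lam.B₂ h.t8

/-- ★★ **The three-law [B8′] slot of record is uninhabited**: `¬ Node00.B8LeafOfRecordSub θ λ` (`θ.D ≥ 2`, every `λ`).
[cite: Balaban1985RegularSpaces, Lemma 1 – Thm 8 pp.79–101 (the typed leaf), Thm 8 (1.146) p.101] -/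
theorem not_b8LeafOfRecordSub (θ : Stage3Params) (hD : 2 ≤ θ.D) (lam : ResidB8 θ) : ¬ B8LeafOfRecordSub θ lam := fun h =>
  not_thm8SurvivingAt_famB8OfRecordSub θ hD lam.β lam.len one_pos lam.B₁ lam.B₂ h.t8

/-- ★★ **The four-law [B8″] slot of record — the conclusion shape of the N05 knits of record and the `b8` leaf of `IsRecordOfRecord₁₃CSB8subB` — is
uninhabited**: `¬ Node00.B8LeafOfRecordSubB θ λ` (`θ.D ≥ 2`, every `λ`).  So `(leavesP w P).b8` is FALSE at every such record and `Dag.B8_main`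
there can hold only ex falso; a TYPING item for the carrier's source space (module docstring (iii)), not a second gap.
[cite: Balaban1985RegularSpaces, Lemma 1 – Thm 8 pp.79–101 (the typed leaf), Thm 8 (1.146) p.101 («Lie algebra valued»)] -/
theorem not_b8LeafOfRecordSubB (θ : Stage3Params) (hD : 2 ≤ θ.D) (lam : ResidB8 θ) : ¬ B8LeafOfRecordSubB θ lam := fun h =>
  not_thm8SurvivingAt_famB8OfRecordSubB θ hD lam.β lam.len one_pos lam.B₁ lam.B₂ h.t8

end Record

#print axioms not_thm8SurvivingAt_zdGF3_lamTop
#print axioms not_b8LeafOfRecordSubB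

end Literature.MathematicalPhysics.QuantumFieldTheory.Balaban1983to89.B8LeafModelZd3SourceReality

end
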